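import Summits.QuantumFields.BalabanUV.Beta.D1BFx.Assembly
import Literature.MathematicalPhysics.QuantumFieldTheory.Balaban1983to89.Beta.SpinTable

/-!
# `BalabanUV.Beta.D1BFx.FrozenCorner` — road «BF-x» for binder row D1, slot (SPLIT) ∕ leaf A1.ii, part 5d (generic half): THE CORNER RE-INDEXING BETWEEN
# SLOT (F)'s FINE INTEGRAND (`t_μ t_ν · K`, μ-bond at `b + t`, ν-bond at `b`) AND an3's `stK` CONVENTION (`w_μ w_ν · K`, `w` = relative position − `u_μ`) COSTS
# EXACTLY ONE FIRST MOMENT, WHICH VANISHES for a kernel odd under the affine axis reflection `w ↦ R_μ w − u_μ` — as `D_{μν}(F)`, `cellForm g` and `bfKernel g N` are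
# for an `R_μ`-invariant leg `g` (OWNER RULING R-10′)

HONEST DEPENDENCY (page 1, mandatory): continuum YM on T⁴ ⇐ BetaPertH ∧ nine spine estimates (0/9 proved); BetaPertH ⇐ (D1) ∧ (D4) ∧
CAP+tail; G-an2-4 gates asym, D1 and NE2/3/4.  HONEST FRAMING (cell contract, verbatim): «discharging `BetaPertH` makes Bałaban's UV
stability UNCONDITIONAL — a real constructive-QFT result; it is NOT the continuum limit and NOT the Clay problem.»  THIS MODULE DISCHARGES
NOTHING of the wall: [folklore] `tsum` re-indexing along equivalences of `ℤ⁴` and three-line algebra on an3's UNMODIFIED `GhostTable.mixedDiffFun` ∕ `fwdDiffFun` ∕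
`cellForm` and `SpinTable.bfKernel`; ONE definition with a body ([our object] `negAt μ`, the sign flip of coordinate `μ` as an `Equiv`; asserts nothing).  No `Prop`
minted, nothing printed asserted, 0 sorry.  0 wall binders; NOT D1, NOT `BetaPertH`, NOT continuum, NOT Clay.

ABSOLUTE RULE (cell charter, verbatim): «No internally-minted statement may enter as a cited fact. Every hypothesis is either kernel-proved in
this package or a verbatim quotation of a PUBLISHED theorem with page reference. The manuscript(s) under audit are NOT citable for their own
disputed steps — they are the thing under adjudication; programme-internal (2001/route/tribunal) claims are never citable.»

WHY (`HOME/b2b-balaban-beta-d1-p2/SPLIT-SPEC.md` §1 R-11 + journal ruling R-10′ 14:22Z).  Part 5e (`MainTable.main_table_eq_stK`) gives MAIN in an3's corner convention: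
second vertex at relative position `v + u_μ`, weight `v_μ v_ν`, value `lam·stK μ ν N g v`.  Slot (F) reads the SAME kernel with the μ-bond at `b + t`, the ν-bond at `b`
and weight `t_μ t_ν`, i.e. `t = −v − u_μ`.  §3 below is the exact book-keeping: `Σ' t, t_μ t_ν·K(−t − u_μ) = Σ' w, w_μ w_ν·K w + Σ' w, w_ν·K w` (μ ≠ ν), and the extra
first moment VANISHES whenever `K (R_μ w − u_μ) = −K w` (§2: the summand `w_ν·K w` is odd under an involution of `ℤ⁴` fixing `w_ν`); §1 shows that an3's cell tables have
this oddness for a leg invariant under `R_μ` — hence R-10′ (symmetrise the frozen diagonal entry under the axis reflections) makes the corner term of node A0's REST list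
EXACTLY ZERO after summation.  (The zeroth moments vanish by the same oddness.)
* §0 [our object] `negAt μ : Pt ≃ Pt` (flip the sign of coordinate `μ`), `cornerRefl μ : Pt ≃ Pt` (`w ↦ negAt μ w − u_μ`, an involution fixing `w_ν`, `ν ≠ μ`).
* §1 ODDNESS OF an3's TABLES under `cornerRefl μ` for an `R_μ`-invariant leg: `mixedDiffFun_cornerRefl`, `cellForm_cornerRefl`, **`bfKernel_cornerRefl`**.
* §2 `tsum_eq_zero_of_odd_invol` (a summable function odd under an involutive `Equiv` sums to `0`), `tsum_firstMoment_eq_zero_of_cornerOdd`, `tsum_eq_zero_of_cornerOdd`.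
* §3 **`tsum_corner_reindex`**: `Σ' t, t_μ t_ν·K (−t − u_μ) = Σ' w, w_μ w_ν·K w + Σ' w, w_ν·K w`; **`tsum_corner_reindex_of_cornerOdd`**: `= Σ' w, w_μ w_ν·K w`.
Unit `b2b-balaban-beta-d1-p2` (road owner, gen 2); `LEAVES-BFx.md` row A1.ii (part 5d, generic half; the leg `gfrz` of R-10′ and its END rows are the other half).
-/

open Finset
open scoped BigOperators
open Literature.MathematicalPhysics.QuantumFieldTheory.Balaban1983to89
open Literature.MathematicalPhysics.QuantumFieldTheory.Balaban1983to89.Beta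
open DyadicShell (Pt toReal)
open BubbleTransfer (unitVec)
open GhostTable (cellForm mixedDiffFun fwdDiffFun)
open SpinTable (bfKernel)

namespace Summit.QuantumFields.BalabanUV.Beta.D1BFx.FrozenCorner

/-! ## §0 The axis sign flip and the corner reflection -/

/-- [our object] **THE SIGN FLIP OF COORDINATE `μ`** on `ℤ⁴` (as a function).  A DEFINITION; asserts nothing. -/
def negAt (μ : Fin 4) (w : Pt) : Pt := fun i => if i = μ then -w i else w i

/-- [our object] Unfolding. -/
theorem negAt_apply (μ : Fin 4) (w : Pt) (i : Fin 4) : negAt μ w i = if i = μ then -w i else w i := rfl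

/-- [folklore] `negAt μ` is an involution. -/
theorem negAt_negAt (μ : Fin 4) (w : Pt) : negAt μ (negAt μ w) = w := by
  funext i
  by_cases h : i = μ <;> simp [negAt_apply, h]

/-- [folklore] `negAt μ` flips `u_μ`. -/
theorem negAt_unitVec_self (μ : Fin 4) : negAt μ (unitVec μ) = -unitVec μ := by
  funext i
  rw [negAt_apply, Pi.neg_apply]
  by_cases h : i = μ
  · rw [if_pos h]
  · rw [if_neg h]; simp [unitVec, h]

/-- [folklore] `negAt μ` fixes `u_ν` for `ν ≠ μ`. -/
theorem negAt_unitVec_ne {μ ν : Fin 4} (h : ν ≠ μ) : negAt μ (unitVec ν) = unitVec ν := by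
  funext i
  rw [negAt_apply]
  by_cases hi : i = μ
  · rw [if_pos hi]; subst hi; simp [unitVec, Ne.symm h]
  · rw [if_neg hi]

/-- [folklore] `negAt μ` is additive. -/
theorem negAt_add (μ : Fin 4) (w w' : Pt) : negAt μ (w + w') = negAt μ w + negAt μ w' := by
  funext i
  simp only [negAt_apply, Pi.add_apply]
  split_ifs <;> ring

/-- [folklore] `negAt μ` commutes with subtraction. -/
theorem negAt_sub (μ : Fin 4) (w w' : Pt) : negAt μ (w - w') = negAt μ w - negAt μ w' := by
  funext i
  simp only [negAt_apply, Pi.sub_apply]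
  split_ifs <;> ring

/-- [folklore] The `ν`-coordinate is fixed by `negAt μ` (`ν ≠ μ`). -/
theorem negAt_apply_ne {μ ν : Fin 4} (h : ν ≠ μ) (w : Pt) : negAt μ w ν = w ν := by
  rw [negAt_apply, if_neg h]

/-- [folklore] The `μ`-coordinate is negated. -/
theorem negAt_apply_self (μ : Fin 4) (w : Pt) : negAt μ w μ = -w μ := by
  rw [negAt_apply, if_pos rfl]

/-- [our object] **THE CORNER REFLECTION** `w ↦ R_μ w − u_μ` (the affine axis reflection through the hyperplane `w_μ = −½`).  A DEFINITION. -/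
def cornerRefl (μ : Fin 4) (w : Pt) : Pt := negAt μ w - unitVec μ

/-- [our object] Unfolding. -/
theorem cornerRefl_apply (μ : Fin 4) (w : Pt) : cornerRefl μ w = negAt μ w - unitVec μ := rfl

/-- [folklore] The corner reflection is an involution. -/
theorem cornerRefl_cornerRefl (μ : Fin 4) (w : Pt) : cornerRefl μ (cornerRefl μ w) = w := by
  rw [cornerRefl_apply, cornerRefl_apply, negAt_sub, negAt_negAt, negAt_unitVec_self, sub_neg_eq_add, add_sub_cancel_right]

/-- [folklore] The corner reflection as an `Equiv` of `ℤ⁴`. -/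
def cornerEquiv (μ : Fin 4) : Pt ≃ Pt := Function.Involutive.toPerm (cornerRefl μ) (cornerRefl_cornerRefl μ)

/-- [our object] Unfolding. -/
theorem cornerEquiv_apply (μ : Fin 4) (w : Pt) : cornerEquiv μ w = cornerRefl μ w := rfl

/-- [folklore] The corner reflection fixes the `ν`-coordinate (`ν ≠ μ`). -/
theorem cornerRefl_apply_ne {μ ν : Fin 4} (h : ν ≠ μ) (w : Pt) : cornerRefl μ w ν = w ν := by
  rw [cornerRefl_apply, Pi.sub_apply, negAt_apply_ne h]
  simp [unitVec, h]

/-! ## §1 Oddness of an3's cell tables under the corner reflection, for an `R_μ`-invariant leg -/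

section Tables

variable {μ ν : Fin 4}

/-- [folklore] **THE MIXED SECOND DIFFERENCE IS ODD UNDER THE CORNER REFLECTION** for an `R_μ`-invariant function (`ν ≠ μ`):
`D F u_μ u_ν (R_μ w − u_μ) = −D F u_μ u_ν w`. -/
theorem mixedDiffFun_cornerRefl (hνμ : ν ≠ μ) {F : Pt → ℝ} (hF : ∀ w, F (negAt μ w) = F w) (w : Pt) :
    mixedDiffFun F (unitVec μ) (unitVec ν) (cornerRefl μ w) = -mixedDiffFun F (unitVec μ) (unitVec ν) w := by
  have e3 : cornerRefl μ w + unitVec ν + unitVec μ = negAt μ (w + unitVec ν) := by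
    rw [cornerRefl_apply, negAt_add, negAt_unitVec_ne hνμ]; abel
  have e2 : cornerRefl μ w + unitVec ν = negAt μ (w + unitVec ν + unitVec μ) := by
    rw [cornerRefl_apply, negAt_add, negAt_add, negAt_unitVec_ne hνμ, negAt_unitVec_self]; abel
  have e1 : cornerRefl μ w + unitVec μ = negAt μ w := by
    rw [cornerRefl_apply]; abel
  have e0 : cornerRefl μ w = negAt μ (w + unitVec μ) := by
    rw [cornerRefl_apply, negAt_add, negAt_unitVec_self]; abel
  unfold mixedDiffFun
  rw [e3, e2, e1, hF, hF, hF]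
  conv_lhs => rw [e0, hF]
  ring

/-- [folklore] **THE CELL FORM IS ODD UNDER THE CORNER REFLECTION** for an `R_μ`-invariant leg (`ν ≠ μ`):
`cellForm g u_μ u_ν (R_μ w − u_μ) = −cellForm g u_μ u_ν w` (a four-value polynomial identity). -/
theorem cellForm_cornerRefl (hνμ : ν ≠ μ) {g : Pt → ℝ} (hg : ∀ w, g (negAt μ w) = g w) (w : Pt) :
    cellForm g (unitVec μ) (unitVec ν) (cornerRefl μ w) = -cellForm g (unitVec μ) (unitVec ν) w := by
  have e3 : cornerRefl μ w + unitVec ν + unitVec μ = negAt μ (w + unitVec ν) := by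
    rw [cornerRefl_apply, negAt_add, negAt_unitVec_ne hνμ]; abel
  have e2 : cornerRefl μ w + unitVec ν = negAt μ (w + unitVec ν + unitVec μ) := by
    rw [cornerRefl_apply, negAt_add, negAt_add, negAt_unitVec_ne hνμ, negAt_unitVec_self]; abel
  have e1 : cornerRefl μ w + unitVec μ = negAt μ w := by
    rw [cornerRefl_apply]; abel
  have e0 : cornerRefl μ w = negAt μ (w + unitVec μ) := by
    rw [cornerRefl_apply, negAt_add, negAt_unitVec_self]; abel
  have hv : g (cornerRefl μ w) = g (w + unitVec μ) := by rw [e0, hg]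
  unfold cellForm mixedDiffFun fwdDiffFun
  rw [e3, e2, e1, hg, hg, hg, hv]
  ring

/-- [folklore] **an3's REALISED KERNEL IS ODD UNDER THE CORNER REFLECTION** for an `R_μ`-invariant leg (`ν ≠ μ`):
`bfKernel g N u_μ u_ν (R_μ w − u_μ) = −bfKernel g N u_μ u_ν w`. -/
theorem bfKernel_cornerRefl (hνμ : ν ≠ μ) {g : Pt → ℝ} (hg : ∀ w, g (negAt μ w) = g w) (N : ℝ) (w : Pt) :
    bfKernel g N (unitVec μ) (unitVec ν) (cornerRefl μ w) = -bfKernel g N (unitVec μ) (unitVec ν) w := by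
  have hg2 : ∀ w, (fun u => g u ^ 2) (negAt μ w) = (fun u => g u ^ 2) w := fun w => by simp only [hg]
  rw [bfKernel, bfKernel, mixedDiffFun_cornerRefl hνμ hg2, cellForm_cornerRefl hνμ hg]
  ring

end Tables

/-! ## §2 Odd summands sum to zero -/

section Odd

/-- [folklore] A function odd under an equivalence of the index type has `tsum` zero (no summability needed: both sides are the junk value otherwise). -/
theorem tsum_eq_zero_of_odd_equiv {f : Pt → ℝ} (e : Pt ≃ Pt) (hf : ∀ w, f (e w) = -f w) : ∑' w, f w = 0 := by
  have h : ∑' w, f (e w) = ∑' w, f w := e.tsum_eq f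
  have h' : ∑' w, f (e w) = -∑' w, f w := by
    rw [← tsum_neg]; exact tsum_congr hf
  linarith

variable {μ ν : Fin 4}

/-- [folklore] **THE FIRST MOMENT IN A FIXED DIRECTION OF A CORNER-ODD KERNEL VANISHES** (`ν ≠ μ`): `K (R_μ w − u_μ) = −K w ⟹ Σ' w, w_ν·K w = 0`. -/
theorem tsum_firstMoment_eq_zero_of_cornerOdd (hνμ : ν ≠ μ) {K : Pt → ℝ} (hK : ∀ w, K (cornerRefl μ w) = -K w) :
    ∑' w : Pt, (w ν : ℝ) * K w = 0 :=
  tsum_eq_zero_of_odd_equiv (cornerEquiv μ) fun w => by rw [cornerEquiv_apply, cornerRefl_apply_ne hνμ, hK, mul_neg]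

/-- [folklore] **THE ZEROTH MOMENT OF A CORNER-ODD KERNEL VANISHES**: `K (R_μ w − u_μ) = −K w ⟹ Σ' w, K w = 0`. -/
theorem tsum_eq_zero_of_cornerOdd {K : Pt → ℝ} (hK : ∀ w, K (cornerRefl μ w) = -K w) : ∑' w : Pt, K w = 0 :=
  tsum_eq_zero_of_odd_equiv (cornerEquiv μ) fun w => by rw [cornerEquiv_apply, hK]

end Odd

/-! ## §3 The corner re-indexing -/

section Reindex

variable {μ ν : Fin 4}

/-- [folklore] The corner substitution `t ↦ −t − u_μ` is an involution of `ℤ⁴`. -/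
theorem cornerSub_invol (μ : Fin 4) (t : Pt) : -(-t - unitVec μ) - unitVec μ = t := by abel

/-- [folklore] The corner substitution as an `Equiv`. -/
def cornerSub (μ : Fin 4) : Pt ≃ Pt := Function.Involutive.toPerm (fun t => -t - unitVec μ) (cornerSub_invol μ)

/-- [our object] Unfolding. -/
theorem cornerSub_apply (μ : Fin 4) (t : Pt) : cornerSub μ t = -t - unitVec μ := rfl

/-- [folklore] **THE CORNER RE-INDEXING**: for `μ ≠ ν` and a kernel `K` whose weighted moments `w_μw_ν·K`, `w_ν·K` are summable,
`Σ' t, t_μ·t_ν·K (−t − u_μ) = Σ' w, w_μ·w_ν·K w + Σ' w, w_ν·K w`. -/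
theorem tsum_corner_reindex (hμν : μ ≠ ν) (K : Pt → ℝ) (h2 : Summable fun w : Pt => (w μ : ℝ) * (w ν : ℝ) * K w)
    (h1 : Summable fun w : Pt => (w ν : ℝ) * K w) :
    ∑' t : Pt, (t μ : ℝ) * (t ν : ℝ) * K (-t - unitVec μ) = (∑' w : Pt, (w μ : ℝ) * (w ν : ℝ) * K w) + ∑' w : Pt, (w ν : ℝ) * K w := by
  have hG : ∀ t : Pt, (t μ : ℝ) * (t ν : ℝ) * K (-t - unitVec μ) =
      (fun w : Pt => ((w μ : ℝ) + 1) * (w ν : ℝ) * K w) (cornerSub μ t) := by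
    intro t
    simp only [cornerSub_apply, Pi.sub_apply, Pi.neg_apply, unitVec, Pi.single_eq_same, Pi.single_eq_of_ne (Ne.symm hμν), Int.cast_sub,
      Int.cast_neg, Int.cast_one, sub_zero]
    ring
  rw [tsum_congr hG, (cornerSub μ).tsum_eq (fun w : Pt => ((w μ : ℝ) + 1) * (w ν : ℝ) * K w), ← h2.tsum_add h1]
  exact tsum_congr fun w => by ring

/-- [folklore] **… AND FOR A CORNER-ODD KERNEL THE EXTRA FIRST MOMENT VANISHES**: `Σ' t, t_μ·t_ν·K (−t − u_μ) = Σ' w, w_μ·w_ν·K w`. -/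
theorem tsum_corner_reindex_of_cornerOdd (hμν : μ ≠ ν) (K : Pt → ℝ) (h2 : Summable fun w : Pt => (w μ : ℝ) * (w ν : ℝ) * K w)
    (h1 : Summable fun w : Pt => (w ν : ℝ) * K w) (hK : ∀ w, K (cornerRefl μ w) = -K w) :
    ∑' t : Pt, (t μ : ℝ) * (t ν : ℝ) * K (-t - unitVec μ) = ∑' w : Pt, (w μ : ℝ) * (w ν : ℝ) * K w := by
  rw [tsum_corner_reindex hμν K h2 h1, tsum_firstMoment_eq_zero_of_cornerOdd (Ne.symm hμν) hK, add_zero]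

end Reindex

end Summit.QuantumFields.BalabanUV.Beta.D1BFx.FrozenCorner
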